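import Mathlib.Algebra.MvPolynomial.PDeriv
import Mathlib.Analysis.Complex.Basic
import Mathlib.Tactic
import Literature.Combinatorics.StablePolynomials.Limits
import HarnessLib

/-!
# The site-product polynomial of THEOREM MT is stable (analytic half of Lemma SR)

Support file for the Sahi / Conjecture-P programme of route `PercNearOneGluingNoHeavy`
(`--supports stmt-CriticalPhenomena-4575`, prover prim-l12-p5 gen 30; proof note
`prim-l12-p5/MULTITYPE-PROOF-g30.md`, §2 Lemma SR).  No definitions, no named facts, no sorries.

In the SITE MODEL of THEOREM MT (LSM-Z-2D for every multi-type de Finetti law with integer rates)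
the state measure at `(a,c)` is a product measure on sites `s ∈ S` (copies with weights
`(1, p_s, q_s)`, neutral slots with weights `(1,1,1)`) conditioned on `#X = a`, `#Y = c`, and the
law of the set of `Y`-sites has generating polynomial proportional to the degree-`c` part of
`Q_a(t) = [u^a] ∏_s (1 + p_s u + q_s t_s) = (1/a!) · (∂_u^a ∏_s (1 + p_s u + q_s t_s))|_{u=0}`.
Lemma SR of the note says that this law is strongly Rayleigh; its analytic input is that `Q_a` is
real stable (then [BBL09, Lemma 4.16] gives the homogeneous parts and [BBL09, Thm 4.19] the
stochastically increasing levels — those two are not in the tree).  Here we prove, with the tree's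
stable-polynomial library (`Literature.Combinatorics.StablePolynomials`):

* `siteFactor_stable` : each affine site factor `1 + p u + q t_s` (`p, q ≥ 0`) is stable
  (variables `Option S`: `none` = `u`, `some s` = `t_s`);
* `siteProduct_stable` : so is the product over all sites;
* `yHeadPoly_zero_or_stable` : `(∂_u^a ∏_s (1 + p_s u + q_s t_s))|_{u := 0}` is `0` or stable
  (iterated derivative and real specialisation preserve stability, Wagner Lemma 2.4 (d),(f) as
  formalised in `…StablePolynomials.Limits`).
-/

namespace Summit.CriticalPhenomena.PercolationContinuityZ3.Theorems

namespace YHeadStable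

open MvPolynomial Literature.Combinatorics.StablePolynomials

variable {S : Type*}

/-- **A site factor is stable**: for `p, q ≥ 0` the affine form `1 + p·u + q·t_s` has no zero with
`Im u, Im t_s > 0` (its imaginary part `p Im u + q Im t_s` vanishes only if `p = q = 0`, and then the
form is the constant `1`). -/
theorem siteFactor_stable (s : S) {p q : ℝ} (hp : 0 ≤ p) (hq : 0 ≤ q) :
    IsUpperHalfPlaneStable
      (C 1 + C (p : ℂ) * X none + C (q : ℂ) * X (some s) : MvPolynomial (Option S) ℂ) := by
  intro z hz h
  simp only [map_add, map_mul, eval_C, eval_X] at h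
  have him := congrArg Complex.im h
  simp only [Complex.add_im, Complex.one_im, Complex.mul_im, Complex.ofReal_re, Complex.ofReal_im,
    zero_mul, add_zero, Complex.zero_im, zero_add] at him
  have h1 : 0 ≤ p * (z none).im := mul_nonneg hp (hz none).le
  have h2 : 0 ≤ q * (z (some s)).im := mul_nonneg hq (hz (some s)).le
  have hp0 : p * (z none).im = 0 := by linarith
  have hq0 : q * (z (some s)).im = 0 := by linarith
  have hp' : p = 0 := by
    rcases mul_eq_zero.1 hp0 with h' | h'
    · exact h'
    · exact absurd h' (ne_of_gt (hz none))
  have hq' : q = 0 := by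
    rcases mul_eq_zero.1 hq0 with h' | h'
    · exact h'
    · exact absurd h' (ne_of_gt (hz (some s)))
  rw [hp', hq'] at h
  have hre := congrArg Complex.re h
  simp at hre

/-- **The site product `∏_s (1 + p_s u + q_s t_s)` is stable** for non-negative weights. -/
theorem siteProduct_stable [Fintype S] (p q : S → ℝ) (hp : ∀ s, 0 ≤ p s) (hq : ∀ s, 0 ≤ q s) :
    IsUpperHalfPlaneStable
      (∏ s, (C 1 + C (p s : ℂ) * X none + C (q s : ℂ) * X (some s)) : MvPolynomial (Option S) ℂ) :=
  isUpperHalfPlaneStable_prod Finset.univ fun s _ => siteFactor_stable s (hp s) (hq s)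

/-- **The `Y`-head polynomial is zero or stable** (MULTITYPE-PROOF-g30 Lemma SR, analytic half):
`(∂_u^a ∏_s (1 + p_s u + q_s t_s))|_{u := 0}` — i.e. `a!` times the coefficient of `u^a`, a
polynomial in the `t_s` alone — is identically zero or stable. -/
theorem yHeadPoly_zero_or_stable [Fintype S] [DecidableEq S] (p q : S → ℝ) (hp : ∀ s, 0 ≤ p s) (hq : ∀ s, 0 ≤ q s) (a : ℕ) :
    bind₁ (Function.update X none (C ((0 : ℝ) : ℂ)))
        ((pderiv none)^[a]
          (∏ s, (C 1 + C (p s : ℂ) * X none + C (q s : ℂ) * X (some s)) :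
            MvPolynomial (Option S) ℂ)) = 0 ∨
      IsUpperHalfPlaneStable
        (bind₁ (Function.update X none (C ((0 : ℝ) : ℂ)))
          ((pderiv none)^[a]
            (∏ s, (C 1 + C (p s : ℂ) * X none + C (q s : ℂ) * X (some s)) :
              MvPolynomial (Option S) ℂ))) := by
  rcases (siteProduct_stable p q hp hq).iterate_pderiv none a with h | h
  · left
    rw [h, map_zero]
  · exact h.specialize_real none 0

end YHeadStable

end Summit.CriticalPhenomena.PercolationContinuityZ3.Theorems
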